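import Literature.NumberTheory.Rogawski1990.ArchSingularCentralizerPinnedFamilyCoherent   -- ★ C3 `centralizer_measure_family_conj_coherent` (brings C2, C1, the (T02)(T01) pins, `continuous_mulAutConj`, `subgroupCongrHomeomorph`)
import Literature.NumberTheory.Rogawski1990.ArchSingularCentralizerProductMeasures         -- ★ (W2) `exists_pi_centralizer_measures` (brings ★ (R1-c) `archPiEquivCM_symm_circleDiagonal_eq_archDiagTorus`, `subgroupPiCoords`)
import Literature.NumberTheory.Automorphic.UnitaryGroupArchTopology                       -- ★ instances `LocallyCompactSpace` ∕ `SecondCountableTopology` ∕ `T2Space` on `U(H)(L⁺ ⊗ ℝ)`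
import HarnessLib

/-!
# Global conjugation coherence of the pinned product centraliser measures on `U(diag α)(L⁺ ⊗ ℝ)`, and the coherent torus datum they extend to
# («(E4b)∕(W3) GLOBAL PRODUCT COHERENCE»; Rogawski (1990) §1.7 p. 6, §4.3 (4.3.1) p. 43, §8.2 pp. 122–124; Deitmar–Echterhoff Thm. 1.5.3)

Topic `NumberTheory/Rogawski1990`.  THEOREMS ONLY (no definition, no instance, no notation, no named fact, no `sorry`).  Cell `pub/hodgecm-mathlib`, ENGINE T1, crux H413 =
`stmt-HodgeConjecture-24833` (supports-only); the (ST-∞) dress of F0P3a-p07's (R1-h)∕(R1-i) chain, F0P3-p03 (g10) census `CENSUS-E4b-SingularPinsBuilt` 1291225b «the singular pins are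
BUILT, not READ», brick (W3) after ★ (W2) p842657 (product∕transport construction) and ★ (W1-coh) C1–C3 (per-place coherence).  Count-neutral plumbing.  HONEST LABEL: HC_CM is proved
only modulo the printed citations until rung 0 closes; this file pays nothing by itself.

WHAT.  ★ (D5) `prod_mul_archStableOrbitalIntegral_kottwitzSign_eq_of_regular_eq_of_clause` reads the singular Weil form `hq : m.atPoint t(z⁰∘ρ) = dν_∞ ∕ d(ρ′ ρ)` at EVERY relabelled
wall torus point `t(z⁰∘ρ) = archDiagTorus L 3 α (z⁰ ∘ ρ)`, `ρ′ ρ` being the product `⊗_w ρZ_w(ρ_w)` of per-place centraliser measures carried to `Z(t(z⁰∘ρ))` (telescope `ρP`, `hρP`, `hρ′`).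
For a Weil-quotient family `m` (★ `OrbitalMeasureFamily.IsQuotientOf … ν T`) such a point reading holds ON THE NOSE iff the torus datum `T` is COHERENT UNDER CONJUGATION on the points
in question (★ `IsQuotientOf.atPoint_eq_quotientMeasure_of_forall_map_conj_eq`: «compatible measures … `c|Ω|` with the same `c`» [§1.7 p. 6, §4.3 p. 43]).  This file supplies that
coherence for the BUILT pins:
* §1 (generic, any topological group `G`; private bookkeeping `map_map_eq_map_of_coords`): `map_subgroupCongrHomeomorph_conj_map_conj` (transport along `conj a` then `conj b` is transport along `conj (b a)`) and
  **`exists_conj_coherent_centralizer_family_of_base`** — centraliser measures `μ i` at base points `b i`, coherent among themselves under every conjugator relating two base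
  points, EXTEND (by choice along conjugators) to a torus datum `T` on the conjugation-saturation of the base points which is coherent under ALL conjugators and restricts to `μ`.
* §2 (the carrier `U(diag α)(L⁺ ⊗ ℝ) ≅ Π_w G_w(α)`): **`centralizer_pi_measure_conj_coherent`** — if at every place the family `σ ↦ ρZ_w(σ)` on the `Z_w(diag(z⁰_w∘σ))` is coherent
  under `G_w(α)`-conjugation (★ C3), then the telescoped products `ρ′ ρ` are coherent under `U(diag α)(L⁺ ⊗ ℝ)`-conjugation between the torus points `t(z⁰∘ρ₁)`, `t(z⁰∘ρ₂)`
  (a conjugator `Q` acts place by place through `e = archPiEquivCM`; Mathlib `Measure.pi_map_pi`).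
* §3 **`exists_conj_coherent_pinned_telescope`** — the ∃-package the (ST-∞) END consumes: from per-place Haar inversion-invariant coherent families `ρZ_w(σ)` there are `ρP`, `ρ′`
  with ★ (D5)'s `hρPi hρP hρ′i hρ′` VERBATIM and a torus datum `T` on the whole carrier, Haar inversion-invariant and conjugation-coherent on the wall classes
  `{q t(z⁰∘ρ) q⁻¹}`, with `T (t(z⁰∘ρ)) = ρ′ ρ` — so that for `m` the Weil quotient of `ν_∞` by `T` on these classes ★ `IsQuotientOf.atPoint_eq_quotientMeasure_of_forall_map_conj_eq`
  gives (D5)'s `hq` at every `ρ`.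
* §4 **`exists_conj_coherent_pinned_telescope_of_links`** — §3 with the per-place coherence DISCHARGED by ★ C3 from the (ST-∞) witness's actual pins: ★ (D5)'s `νH hνH ρZ hρZi hρZ`
  binders VERBATIM + the (T02)(T01) links (★ `…PinTransport`'s outputs) + probability mass at the compact walls.

## References
* [Rogawski1990] J. D. Rogawski, *Automorphic Representations of Unitary Groups in Three Variables*, Ann. of Math. Stud. 123 (1990), §1.7 p. 6; §4.3 (4.3.1) p. 43; §8.2
  pp. 122–124; §14.5 p. 238.
* [DeitmarEchterhoff2014] A. Deitmar, S. Echterhoff, *Principles of Harmonic Analysis*, 2nd ed. (2014), Thm. 1.5.3 (invariant quotient measure, uniqueness up to a scalar).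
* [Folland1995] G. B. Folland, *A Course in Abstract Harmonic Analysis* (1995), §2.6 (2.52) (product Haar measures).
-/

set_option autoImplicit false

noncomputable section

open MeasureTheory Measure Set NumberField NumberField.InfinitePlace Matrix Equiv
open Literature.MeasureTheory.Group Literature.NumberTheory.Automorphic Literature.NumberTheory.Automorphic.UnitaryGroup
open scoped ENNReal NNReal Classical MatrixGroups

/-! ## §1 Generic: composing conjugation transports; extending coherent base data to a coherent torus datum -/

namespace Literature.NumberTheory.Automorphic

section Generic

variable {G : Type*} [Group G] [TopologicalSpace G] [IsTopologicalGroup G] [MeasurableSpace G] [BorelSpace G]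

omit [IsTopologicalGroup G] [MeasurableSpace G] [BorelSpace G] in
/-- The inverse of `subgroupCongrHomeomorph e H H'` on underlying elements (definitional). [folklore] -/
private theorem coe_subgroupCongrHomeomorph_symm_apply {G' : Type*} [Group G'] [TopologicalSpace G'] (e : G ≃* G') (he : Continuous e) (hes : Continuous e.symm)
    (H : Subgroup G) (H' : Subgroup G') (hHH' : ∀ g, e g ∈ H' ↔ g ∈ H) (h' : H') :
    ((subgroupCongrHomeomorph e H H' hHH' he hes).symm h' : G) = e.symm h' := rfl

/-- **Transport along `conj a : Z(γ₁) ≃ Z(γ₂)` then along `conj b : Z(γ₂) ≃ Z(γ₃)` is transport along `conj c : Z(γ₁) ≃ Z(γ₃)` whenever `b a = c`.**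
[cite: DeitmarEchterhoff2014, Thm. 1.5.3] -/
theorem map_subgroupCongrHomeomorph_conj_map_conj {γ₁ γ₂ γ₃ : G} (a b c : G)
    (ha : (MulAut.conj a : G ≃* G) γ₁ = γ₂) (hb : (MulAut.conj b : G ≃* G) γ₂ = γ₃) (hc : (MulAut.conj c : G ≃* G) γ₁ = γ₃) (hbac : b * a = c)
    (μ : Measure (Subgroup.centralizer ({γ₁} : Set G))) :
    (μ.map (subgroupCongrHomeomorph (MulAut.conj a : G ≃* G) (Subgroup.centralizer ({γ₁} : Set G)) (Subgroup.centralizer ({γ₂} : Set G)) (forall_apply_mem_centralizer_singleton_iff_of_eq (MulAut.conj a : G ≃* G) ha) (continuous_mulAutConj a) (continuous_mulAutConj_symm a))).map (subgroupCongrHomeomorph (MulAut.conj b : G ≃* G) (Subgroup.centralizer ({γ₂} : Set G)) (Subgroup.centralizer ({γ₃} : Set G)) (forall_apply_mem_centralizer_singleton_iff_of_eq (MulAut.conj b : G ≃* G) hb) (continuous_mulAutConj b) (continuous_mulAutConj_symm b)) =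
      μ.map (subgroupCongrHomeomorph (MulAut.conj c : G ≃* G) (Subgroup.centralizer ({γ₁} : Set G)) (Subgroup.centralizer ({γ₃} : Set G)) (forall_apply_mem_centralizer_singleton_iff_of_eq (MulAut.conj c : G ≃* G) hc) (continuous_mulAutConj c) (continuous_mulAutConj_symm c)) := by
  rw [Measure.map_map (Homeomorph.measurable _) (Homeomorph.measurable _)]
  congr 1
  funext x
  apply Subtype.ext
  simp only [Function.comp_apply, coe_subgroupCongrHomeomorph_apply, MulAut.conj_apply, ← hbac, _root_.mul_inv_rev, mul_assoc]

/-- **EXTENDING COHERENT BASE DATA TO A COHERENT TORUS DATUM.**  Let `b : ι → G` be base points carrying centraliser measures `μ i` on `Z(b i)` which are coherent among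
themselves: whenever `q (b i) q⁻¹ = b j`, transporting `μ i` along `conj q` gives `μ j` (for `i = j` this says `μ i` is invariant under the `G`-normaliser action).  Then there is
a torus datum `T γ` on every centraliser with `T (b i) = μ i`, which on the saturation `{q (b i) q⁻¹}` is a conjugation-transport of base data and is COHERENT UNDER EVERY
CONJUGATOR — the hypothesis `hcoh` of ★ `OrbitalMeasureFamily.IsQuotientOf.atPoint_eq_quotientMeasure_of_forall_map_conj_eq` for the guard «lies in the saturation».
(Choice along conjugators; well-defined exactly by the base coherence.) [cite: Rogawski1990, §1.7 p. 6; §4.3 (4.3.1) p. 43] [cite: DeitmarEchterhoff2014, Thm. 1.5.3] -/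
theorem exists_conj_coherent_centralizer_family_of_base {ι : Type*} (b : ι → G) (μ : ∀ i, Measure (Subgroup.centralizer ({b i} : Set G)))
    (hμ : ∀ (i j : ι) (q : G) (hq : (MulAut.conj q : G ≃* G) (b i) = b j), (μ i).map (subgroupCongrHomeomorph (MulAut.conj q : G ≃* G) (Subgroup.centralizer ({b i} : Set G)) (Subgroup.centralizer ({b j} : Set G)) (forall_apply_mem_centralizer_singleton_iff_of_eq (MulAut.conj q : G ≃* G) hq) (continuous_mulAutConj q) (continuous_mulAutConj_symm q)) = μ j) :
    ∃ T : ∀ γ : G, Measure (Subgroup.centralizer ({γ} : Set G)),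
      (∀ i, T (b i) = μ i) ∧
      (∀ γ : G, (∃ (i : ι) (q₀ : G), (MulAut.conj q₀ : G ≃* G) (b i) = γ) →
        ∃ (i : ι) (q₀ : G) (h : (MulAut.conj q₀ : G ≃* G) (b i) = γ), T γ = (μ i).map (subgroupCongrHomeomorph (MulAut.conj q₀ : G ≃* G) (Subgroup.centralizer ({b i} : Set G)) (Subgroup.centralizer ({γ} : Set G)) (forall_apply_mem_centralizer_singleton_iff_of_eq (MulAut.conj q₀ : G ≃* G) h) (continuous_mulAutConj q₀) (continuous_mulAutConj_symm q₀))) ∧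
      ∀ (γ₁ γ₂ q : G) (hq : (MulAut.conj q : G ≃* G) γ₁ = γ₂), (∃ (i : ι) (q₀ : G), (MulAut.conj q₀ : G ≃* G) (b i) = γ₁) →
        (T γ₁).map (subgroupCongrHomeomorph (MulAut.conj q : G ≃* G) (Subgroup.centralizer ({γ₁} : Set G)) (Subgroup.centralizer ({γ₂} : Set G)) (forall_apply_mem_centralizer_singleton_iff_of_eq (MulAut.conj q : G ≃* G) hq) (continuous_mulAutConj q) (continuous_mulAutConj_symm q)) = T γ₂ := by
  classical
  -- the datum: along a CHOSEN conjugator from a CHOSEN base point; junk `0` off the saturation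
  let T : ∀ γ : G, Measure (Subgroup.centralizer ({γ} : Set G)) := fun γ =>
    if h : ∃ (i : ι) (q₀ : G), (MulAut.conj q₀ : G ≃* G) (b i) = γ then
      (μ h.choose).map (subgroupCongrHomeomorph (MulAut.conj h.choose_spec.choose : G ≃* G) (Subgroup.centralizer ({b h.choose} : Set G)) (Subgroup.centralizer ({γ} : Set G)) (forall_apply_mem_centralizer_singleton_iff_of_eq (MulAut.conj h.choose_spec.choose : G ≃* G) h.choose_spec.choose_spec) (continuous_mulAutConj h.choose_spec.choose) (continuous_mulAutConj_symm h.choose_spec.choose))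
    else 0
  have hT : ∀ (γ : G) (h : ∃ (i : ι) (q₀ : G), (MulAut.conj q₀ : G ≃* G) (b i) = γ),
      T γ = (μ h.choose).map (subgroupCongrHomeomorph (MulAut.conj h.choose_spec.choose : G ≃* G) (Subgroup.centralizer ({b h.choose} : Set G)) (Subgroup.centralizer ({γ} : Set G)) (forall_apply_mem_centralizer_singleton_iff_of_eq (MulAut.conj h.choose_spec.choose : G ≃* G) h.choose_spec.choose_spec) (continuous_mulAutConj h.choose_spec.choose) (continuous_mulAutConj_symm h.choose_spec.choose)) := fun γ h => by
    simp only [T, dif_pos h]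
  -- coherence from a presentation: if `T γ₁` is presented from base point `i` along `q₁`, then its transport along any `q` is `T (q γ₁ q⁻¹)`
  have key : ∀ (γ₁ γ₂ q : G) (hq : (MulAut.conj q : G ≃* G) γ₁ = γ₂) (i : ι) (q₁ : G) (h₁ : (MulAut.conj q₁ : G ≃* G) (b i) = γ₁),
      ((μ i).map (subgroupCongrHomeomorph (MulAut.conj q₁ : G ≃* G) (Subgroup.centralizer ({b i} : Set G)) (Subgroup.centralizer ({γ₁} : Set G)) (forall_apply_mem_centralizer_singleton_iff_of_eq (MulAut.conj q₁ : G ≃* G) h₁) (continuous_mulAutConj q₁) (continuous_mulAutConj_symm q₁))).map (subgroupCongrHomeomorph (MulAut.conj q : G ≃* G) (Subgroup.centralizer ({γ₁} : Set G)) (Subgroup.centralizer ({γ₂} : Set G)) (forall_apply_mem_centralizer_singleton_iff_of_eq (MulAut.conj q : G ≃* G) hq) (continuous_mulAutConj q) (continuous_mulAutConj_symm q)) = T γ₂ := by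
    intro γ₁ γ₂ q hq i q₁ h₁
    have h₂ : ∃ (j : ι) (q₀ : G), (MulAut.conj q₀ : G ≃* G) (b j) = γ₂ := ⟨i, q * q₁, by rw [map_mul, MulAut.mul_apply, h₁, hq]⟩
    rw [hT γ₂ h₂]
    -- the chosen presentation of `γ₂`: base point `j`, conjugator `q₂`; the ratio `r = q₂⁻¹ q q₁` relates the two base points
    set j := h₂.choose with hj
    set q₂ := h₂.choose_spec.choose with hq₂
    have h₂' : (MulAut.conj q₂ : G ≃* G) (b j) = γ₂ := h₂.choose_spec.choose_spec
    have hr : (MulAut.conj (q₂⁻¹ * (q * q₁)) : G ≃* G) (b i) = b j := by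
      rw [map_mul, MulAut.mul_apply, map_mul, MulAut.mul_apply, h₁, hq, ← h₂', ← MulAut.mul_apply, ← map_mul, inv_mul_cancel, map_one, MulAut.one_apply]
    rw [map_subgroupCongrHomeomorph_conj_map_conj q₁ q (q * q₁) h₁ hq (by rw [map_mul, MulAut.mul_apply, h₁, hq]) rfl,
      ← hμ i j (q₂⁻¹ * (q * q₁)) hr,
      map_subgroupCongrHomeomorph_conj_map_conj (q₂⁻¹ * (q * q₁)) q₂ (q * q₁) hr h₂' (by rw [map_mul, MulAut.mul_apply, h₁, hq]) (by rw [mul_inv_cancel_left])]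
  refine ⟨T, fun i => ?_, fun γ h => ⟨h.choose, h.choose_spec.choose, h.choose_spec.choose_spec, hT γ h⟩, fun γ₁ γ₂ q hq h => ?_⟩
  · -- at a base point: presented from base point `j` along `q₀`, and base coherence
    have h : ∃ (j : ι) (q₀ : G), (MulAut.conj q₀ : G ≃* G) (b j) = b i := ⟨i, 1, by rw [map_one, MulAut.one_apply]⟩
    rw [hT (b i) h]
    exact hμ _ _ _ h.choose_spec.choose_spec
  · rw [hT γ₁ h]
    exact key γ₁ γ₂ q hq _ _ h.choose_spec.choose_spec

/-- **Change of coordinates for a transport identity** (abstract measure bookkeeping).  If `μ₂`'s coordinates `e₂` are the image of `μ₁`'s coordinates `e₁` under `F`, and in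
coordinates the composite `E₂⁻¹ ∘ C ∘ E₁` is `F` (`e₂ ∘ E₂′ ∘ C ∘ E₁ = F ∘ e₁`, `E₂′`, `e₂′` one-sided inverses), then `C_* (E₁)_* μ₁ = (E₂)_* μ₂`. [folklore] -/
private theorem map_map_eq_map_of_coords {S₁ S₂ Z₁ Z₂ P₁ P₂ : Type*} [MeasurableSpace S₁] [MeasurableSpace S₂] [MeasurableSpace Z₁] [MeasurableSpace Z₂]
    [MeasurableSpace P₁] [MeasurableSpace P₂]
    {E₁ : S₁ → Z₁} {C : Z₁ → Z₂} {E₂ : S₂ → Z₂} {E₂' : Z₂ → S₂} (hE₁ : Measurable E₁) (hC : Measurable C) (hE₂ : Measurable E₂) (hE₂' : Measurable E₂')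
    (hEE : ∀ z, E₂ (E₂' z) = z)
    {e₁ : S₁ → P₁} {e₂ : S₂ → P₂} {e₂' : P₂ → S₂} (he₁ : Measurable e₁) (he₂ : Measurable e₂) (he₂' : Measurable e₂') (hee : ∀ s, e₂' (e₂ s) = s)
    {F : P₁ → P₂} (hF : Measurable F) (hfun : ∀ x, e₂ (E₂' (C (E₁ x))) = F (e₁ x))
    {μ₁ : Measure S₁} {μ₂ : Measure S₂} (h : (μ₁.map e₁).map F = μ₂.map e₂) :
    (μ₁.map E₁).map C = μ₂.map E₂ := by
  have h2 : μ₂ = μ₁.map (E₂' ∘ C ∘ E₁) := by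
    have h3 := congrArg (Measure.map e₂') h
    rw [Measure.map_map he₂' he₂, Measure.map_map hF he₁, Measure.map_map he₂' (hF.comp he₁), show (e₂' ∘ e₂) = id from funext hee,
      Measure.map_id] at h3
    rw [← h3]
    congr 1
    funext x
    simp only [Function.comp_apply, ← hfun, hee]
  rw [h2, Measure.map_map hC hE₁, Measure.map_map hE₂ (hE₂'.comp (hC.comp hE₁))]
  congr 1
  funext x
  simp only [Function.comp_apply, hEE]

end Generic

end Literature.NumberTheory.Automorphic

/-! ## §2 The carrier `U(diag α)(L⁺ ⊗ ℝ) ≅ Π_w G_w(α)`: per-place coherence ⟹ global coherence of the telescoped products -/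

namespace Literature.NumberTheory.Rogawski1990

variable (L : Type) [Field L] [NumberField L] [IsCMField L] (α : Fin 3 → L)

/-- A conjugator between two wall torus points acts place by place: `(e Q)_w` conjugates `diag(z⁰_w∘ρ₁ w)` to `diag(z⁰_w∘ρ₂ w)` in `G_w(α)`.
[cite: Rogawski1990, §1.7 p. 6] -/
theorem conj_archPiEquivCM_apply_circleDiagonal_of_conj_archDiagTorus (z0 : {w : InfinitePlace L // IsComplex w} → Fin 3 → Circle) (ρ₁ ρ₂ : {w : InfinitePlace L // IsComplex w} → Perm (Fin 3)) (Q : arch (↥(maximalRealSubfield L)) L (IsCMField.complexConj L) 3 (Matrix.diagonal α))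
    (hQ : (MulAut.conj Q : arch (↥(maximalRealSubfield L)) L (IsCMField.complexConj L) 3 (Matrix.diagonal α) ≃* arch (↥(maximalRealSubfield L)) L (IsCMField.complexConj L) 3 (Matrix.diagonal α)) (archDiagTorus L 3 α (fun w => z0 w ∘ ⇑(ρ₁ w))) = archDiagTorus L 3 α (fun w => z0 w ∘ ⇑(ρ₂ w))) (w : {w : InfinitePlace L // IsComplex w}) :
    (MulAut.conj ((archPiEquivCM 3 L (Matrix.diagonal α)) Q w) : archLocal L 3 (Matrix.diagonal α) w ≃* archLocal L 3 (Matrix.diagonal α) w) (⟨circleDiagonal 3 (z0 w ∘ ⇑(ρ₁ w)), circleDiagonal_mem_archLocal_diagonal L 3 α w (z0 w ∘ ⇑(ρ₁ w))⟩ : archLocal L 3 (Matrix.diagonal α) w) = (⟨circleDiagonal 3 (z0 w ∘ ⇑(ρ₂ w)), circleDiagonal_mem_archLocal_diagonal L 3 α w (z0 w ∘ ⇑(ρ₂ w))⟩ : archLocal L 3 (Matrix.diagonal α) w) := by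
  have h1 : (archPiEquivCM 3 L (Matrix.diagonal α)) (archDiagTorus L 3 α (fun w => z0 w ∘ ⇑(ρ₁ w))) = fun w => (⟨circleDiagonal 3 (z0 w ∘ ⇑(ρ₁ w)), circleDiagonal_mem_archLocal_diagonal L 3 α w (z0 w ∘ ⇑(ρ₁ w))⟩ : archLocal L 3 (Matrix.diagonal α) w) := by
    rw [← archPiEquivCM_symm_circleDiagonal_eq_archDiagTorus L 3 α (fun w => z0 w ∘ ⇑(ρ₁ w)), ContinuousMulEquiv.apply_symm_apply]
  have h2 : (archPiEquivCM 3 L (Matrix.diagonal α)) (archDiagTorus L 3 α (fun w => z0 w ∘ ⇑(ρ₂ w))) = fun w => (⟨circleDiagonal 3 (z0 w ∘ ⇑(ρ₂ w)), circleDiagonal_mem_archLocal_diagonal L 3 α w (z0 w ∘ ⇑(ρ₂ w))⟩ : archLocal L 3 (Matrix.diagonal α) w) := by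
    rw [← archPiEquivCM_symm_circleDiagonal_eq_archDiagTorus L 3 α (fun w => z0 w ∘ ⇑(ρ₂ w)), ContinuousMulEquiv.apply_symm_apply]
  have h3 := congrArg (fun g => (archPiEquivCM 3 L (Matrix.diagonal α)) g w) hQ
  simp only [MulAut.conj_apply, map_mul, map_inv, Pi.mul_apply, Pi.inv_apply] at h3
  rw [h1, h2] at h3
  simpa only [MulAut.conj_apply] using h3

variable [MeasurableSpace (arch (↥(maximalRealSubfield L)) L (IsCMField.complexConj L) 3 (Matrix.diagonal α))] [BorelSpace (arch (↥(maximalRealSubfield L)) L (IsCMField.complexConj L) 3 (Matrix.diagonal α))]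

section Abstract

variable [∀ w : {w : InfinitePlace L // IsComplex w}, MeasurableSpace (archLocal L 3 (Matrix.diagonal α) w)] [∀ w : {w : InfinitePlace L // IsComplex w}, BorelSpace (archLocal L 3 (Matrix.diagonal α) w)]
  [iSC : ∀ w : {w : InfinitePlace L // IsComplex w}, SecondCountableTopology (archLocal L 3 (Matrix.diagonal α) w)] [iLC : ∀ w : {w : InfinitePlace L // IsComplex w}, LocallyCompactSpace (archLocal L 3 (Matrix.diagonal α) w)]

/-- **PER-PLACE COHERENCE ⟹ GLOBAL COHERENCE OF THE TELESCOPED PRODUCTS.**  If at every complex place `w` the centraliser measures `σ ↦ ρZ_w(σ)` on the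
`Z_w(diag(z⁰_w∘σ)) ≤ G_w(α)` are coherent under `G_w(α)`-conjugation (★ C3 `centralizer_measure_family_conj_coherent`), then for the telescope (`hρP`: coordinates of `ρP ρ` =
`⊗_w ρZ_w(ρ_w)`; `hρ′`: `ρ′ ρ` = transport of `ρP ρ` to `Z(t(z⁰∘ρ))` along `e⁻¹`, ★ (D5)'s binders VERBATIM) and every `Q ∈ U(diag α)(L⁺ ⊗ ℝ)` conjugating `t(z⁰∘ρ₁)` to
`t(z⁰∘ρ₂)`: transporting `ρ′ ρ₁` along `conj Q` gives `ρ′ ρ₂`.  (`Q` acts through its components `(e Q)_w`; Mathlib `Measure.pi_map_pi`; the coordinates `subgroupPiCoords` are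
a homeomorphism, so measures on `Π_w Z_w` are determined by their coordinates.) [cite: Rogawski1990, §1.7 p. 6; §4.3 (4.3.1) p. 43] [cite: Folland1995, §2.6 (2.52)] -/
theorem centralizer_pi_measure_conj_coherent (z0 : {w : InfinitePlace L // IsComplex w} → Fin 3 → Circle)
    (ρZ : ∀ (w : {w : InfinitePlace L // IsComplex w}) (σ : Perm (Fin 3)), Measure (Subgroup.centralizer ({(⟨circleDiagonal 3 (z0 w ∘ ⇑σ), circleDiagonal_mem_archLocal_diagonal L 3 α w (z0 w ∘ ⇑σ)⟩ : archLocal L 3 (Matrix.diagonal α) w)} : Set (archLocal L 3 (Matrix.diagonal α) w))))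
    (hρZi : ∀ w σ, (ρZ w σ).IsHaarMeasure ∧ (ρZ w σ).IsInvInvariant)
    (hcohw : ∀ (w : {w : InfinitePlace L // IsComplex w}) (σ₁ σ₂ : Perm (Fin 3)) (g : archLocal L 3 (Matrix.diagonal α) w) (hg : (MulAut.conj g : archLocal L 3 (Matrix.diagonal α) w ≃* archLocal L 3 (Matrix.diagonal α) w) (⟨circleDiagonal 3 (z0 w ∘ ⇑σ₁), circleDiagonal_mem_archLocal_diagonal L 3 α w (z0 w ∘ ⇑σ₁)⟩ : archLocal L 3 (Matrix.diagonal α) w) = (⟨circleDiagonal 3 (z0 w ∘ ⇑σ₂), circleDiagonal_mem_archLocal_diagonal L 3 α w (z0 w ∘ ⇑σ₂)⟩ : archLocal L 3 (Matrix.diagonal α) w)),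
      (ρZ w σ₁).map (subgroupCongrHomeomorph (MulAut.conj g : archLocal L 3 (Matrix.diagonal α) w ≃* archLocal L 3 (Matrix.diagonal α) w) (Subgroup.centralizer ({(⟨circleDiagonal 3 (z0 w ∘ ⇑σ₁), circleDiagonal_mem_archLocal_diagonal L 3 α w (z0 w ∘ ⇑σ₁)⟩ : archLocal L 3 (Matrix.diagonal α) w)} : Set (archLocal L 3 (Matrix.diagonal α) w))) (Subgroup.centralizer ({(⟨circleDiagonal 3 (z0 w ∘ ⇑σ₂), circleDiagonal_mem_archLocal_diagonal L 3 α w (z0 w ∘ ⇑σ₂)⟩ : archLocal L 3 (Matrix.diagonal α) w)} : Set (archLocal L 3 (Matrix.diagonal α) w))) (forall_apply_mem_centralizer_singleton_iff_of_eq (MulAut.conj g : archLocal L 3 (Matrix.diagonal α) w ≃* archLocal L 3 (Matrix.diagonal α) w) hg) (continuous_mulAutConj g) (continuous_mulAutConj_symm g)) = ρZ w σ₂)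
    (ρP : ∀ ρ : {w : InfinitePlace L // IsComplex w} → Perm (Fin 3), Measure (Subgroup.pi Set.univ (fun w : {w : InfinitePlace L // IsComplex w} => Subgroup.centralizer ({(⟨circleDiagonal 3 (z0 w ∘ ⇑(ρ w)), circleDiagonal_mem_archLocal_diagonal L 3 α w (z0 w ∘ ⇑(ρ w))⟩ : archLocal L 3 (Matrix.diagonal α) w)} : Set (archLocal L 3 (Matrix.diagonal α) w)))))
    (hρP : ∀ ρ : {w : InfinitePlace L // IsComplex w} → Perm (Fin 3), Measure.map (subgroupPiCoords fun w : {w : InfinitePlace L // IsComplex w} => Subgroup.centralizer ({(⟨circleDiagonal 3 (z0 w ∘ ⇑(ρ w)), circleDiagonal_mem_archLocal_diagonal L 3 α w (z0 w ∘ ⇑(ρ w))⟩ : archLocal L 3 (Matrix.diagonal α) w)} : Set (archLocal L 3 (Matrix.diagonal α) w))) (ρP ρ) = Measure.pi fun w => ρZ w (ρ w))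
    (ρ' : ∀ ρ : {w : InfinitePlace L // IsComplex w} → Perm (Fin 3), Measure (Subgroup.centralizer ({archDiagTorus L 3 α (fun w => z0 w ∘ ⇑(ρ w))} : Set (arch (↥(maximalRealSubfield L)) L (IsCMField.complexConj L) 3 (Matrix.diagonal α)))))
    (hρ' : ∀ ρ : {w : InfinitePlace L // IsComplex w} → Perm (Fin 3), ρ' ρ = (ρP ρ).map (subgroupCongrHomeomorph (archPiEquivCM 3 L (Matrix.diagonal α)).symm.toMulEquiv (Subgroup.pi Set.univ (fun w : {w : InfinitePlace L // IsComplex w} => Subgroup.centralizer ({(⟨circleDiagonal 3 (z0 w ∘ ⇑(ρ w)), circleDiagonal_mem_archLocal_diagonal L 3 α w (z0 w ∘ ⇑(ρ w))⟩ : archLocal L 3 (Matrix.diagonal α) w)} : Set (archLocal L 3 (Matrix.diagonal α) w)))) (Subgroup.centralizer ({archDiagTorus L 3 α (fun w => z0 w ∘ ⇑(ρ w))} : Set (arch (↥(maximalRealSubfield L)) L (IsCMField.complexConj L) 3 (Matrix.diagonal α)))) (apply_mem_centralizer_iff_mem_pi_centralizer _ (archPiEquivCM 3 L (Matrix.diagonal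 α)).symm.toMulEquiv (archPiEquivCM_symm_circleDiagonal_eq_archDiagTorus L 3 α (fun w => z0 w ∘ ⇑(ρ w)))) (archPiEquivCM 3 L (Matrix.diagonal α)).symm.continuous (archPiEquivCM 3 L (Matrix.diagonal α)).continuous))
    (ρ₁ ρ₂ : {w : InfinitePlace L // IsComplex w} → Perm (Fin 3)) (Q : arch (↥(maximalRealSubfield L)) L (IsCMField.complexConj L) 3 (Matrix.diagonal α)) (hQ : (MulAut.conj Q : arch (↥(maximalRealSubfield L)) L (IsCMField.complexConj L) 3 (Matrix.diagonal α) ≃* arch (↥(maximalRealSubfield L)) L (IsCMField.complexConj L) 3 (Matrix.diagonal α)) (archDiagTorus L 3 α (fun w => z0 w ∘ ⇑(ρ₁ w))) = archDiagTorus L 3 α (fun w => z0 w ∘ ⇑(ρ₂ w))) :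
    (ρ' ρ₁).map (subgroupCongrHomeomorph (MulAut.conj Q : arch (↥(maximalRealSubfield L)) L (IsCMField.complexConj L) 3 (Matrix.diagonal α) ≃* arch (↥(maximalRealSubfield L)) L (IsCMField.complexConj L) 3 (Matrix.diagonal α)) (Subgroup.centralizer ({archDiagTorus L 3 α (fun w => z0 w ∘ ⇑(ρ₁ w))} : Set (arch (↥(maximalRealSubfield L)) L (IsCMField.complexConj L) 3 (Matrix.diagonal α)))) (Subgroup.centralizer ({archDiagTorus L 3 α (fun w => z0 w ∘ ⇑(ρ₂ w))} : Set (arch (↥(maximalRealSubfield L)) L (IsCMField.complexConj L) 3 (Matrix.diagonal α)))) (forall_apply_mem_centralizer_singleton_iff_of_eq (MulAut.conj Q : arch (↥(maximalRealSubfield L)) L (IsCMField.complexConj L) 3 (Matrix.diagonal α) ≃* arch (↥(maximalRealSubfield L)) L (IsCMField.complexConj L) 3 (Matrix.diagonal α)) hQ) (continuous_mulAutConj Q) (continuous_mulAutConj_symm Q)) = ρ' ρ₂ := by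
  -- instances on the factors
  haveI hZh : ∀ w σ, (ρZ w σ).IsHaarMeasure := fun w σ => (hρZi w σ).1
  haveI hLCw : ∀ (w : {w : InfinitePlace L // IsComplex w}) (σ : Perm (Fin 3)), LocallyCompactSpace (Subgroup.centralizer ({(⟨circleDiagonal 3 (z0 w ∘ ⇑σ), circleDiagonal_mem_archLocal_diagonal L 3 α w (z0 w ∘ ⇑σ)⟩ : archLocal L 3 (Matrix.diagonal α) w)} : Set (archLocal L 3 (Matrix.diagonal α) w))) :=
    fun w σ => (isClosed_coe_centralizer_singleton _).isClosedEmbedding_subtypeVal.locallyCompactSpace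
  haveI hSCw : ∀ (w : {w : InfinitePlace L // IsComplex w}) (σ : Perm (Fin 3)), SecondCountableTopology (Subgroup.centralizer ({(⟨circleDiagonal 3 (z0 w ∘ ⇑σ), circleDiagonal_mem_archLocal_diagonal L 3 α w (z0 w ∘ ⇑σ)⟩ : archLocal L 3 (Matrix.diagonal α) w)} : Set (archLocal L 3 (Matrix.diagonal α) w))) :=
    fun w σ => TopologicalSpace.Subtype.secondCountableTopology _
  have he₁c : Continuous (⇑(subgroupPiCoords fun w : {w : InfinitePlace L // IsComplex w} => Subgroup.centralizer ({(⟨circleDiagonal 3 (z0 w ∘ ⇑(ρ₁ w)), circleDiagonal_mem_archLocal_diagonal L 3 α w (z0 w ∘ ⇑(ρ₁ w))⟩ : archLocal L 3 (Matrix.diagonal α) w)} : Set (archLocal L 3 (Matrix.diagonal α) w)))) :=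
    (subgroupPiHomeomorph fun w : {w : InfinitePlace L // IsComplex w} => Subgroup.centralizer ({(⟨circleDiagonal 3 (z0 w ∘ ⇑(ρ₁ w)), circleDiagonal_mem_archLocal_diagonal L 3 α w (z0 w ∘ ⇑(ρ₁ w))⟩ : archLocal L 3 (Matrix.diagonal α) w)} : Set (archLocal L 3 (Matrix.diagonal α) w))).continuous
  have he₂c : Continuous (⇑(subgroupPiCoords fun w : {w : InfinitePlace L // IsComplex w} => Subgroup.centralizer ({(⟨circleDiagonal 3 (z0 w ∘ ⇑(ρ₂ w)), circleDiagonal_mem_archLocal_diagonal L 3 α w (z0 w ∘ ⇑(ρ₂ w))⟩ : archLocal L 3 (Matrix.diagonal α) w)} : Set (archLocal L 3 (Matrix.diagonal α) w)))) :=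
    (subgroupPiHomeomorph fun w : {w : InfinitePlace L // IsComplex w} => Subgroup.centralizer ({(⟨circleDiagonal 3 (z0 w ∘ ⇑(ρ₂ w)), circleDiagonal_mem_archLocal_diagonal L 3 α w (z0 w ∘ ⇑(ρ₂ w))⟩ : archLocal L 3 (Matrix.diagonal α) w)} : Set (archLocal L 3 (Matrix.diagonal α) w))).continuous
  have he₂sc : Continuous (⇑(subgroupPiCoords fun w : {w : InfinitePlace L // IsComplex w} => Subgroup.centralizer ({(⟨circleDiagonal 3 (z0 w ∘ ⇑(ρ₂ w)), circleDiagonal_mem_archLocal_diagonal L 3 α w (z0 w ∘ ⇑(ρ₂ w))⟩ : archLocal L 3 (Matrix.diagonal α) w)} : Set (archLocal L 3 (Matrix.diagonal α) w))).symm) :=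
    (subgroupPiHomeomorph fun w : {w : InfinitePlace L // IsComplex w} => Subgroup.centralizer ({(⟨circleDiagonal 3 (z0 w ∘ ⇑(ρ₂ w)), circleDiagonal_mem_archLocal_diagonal L 3 α w (z0 w ∘ ⇑(ρ₂ w))⟩ : archLocal L 3 (Matrix.diagonal α) w)} : Set (archLocal L 3 (Matrix.diagonal α) w))).symm.continuous
  -- the componentwise conjugations `(e Q)_w`
  have hQw : ∀ w : {w : InfinitePlace L // IsComplex w}, (MulAut.conj ((archPiEquivCM 3 L (Matrix.diagonal α)) Q w) : archLocal L 3 (Matrix.diagonal α) w ≃* archLocal L 3 (Matrix.diagonal α) w) (⟨circleDiagonal 3 (z0 w ∘ ⇑(ρ₁ w)), circleDiagonal_mem_archLocal_diagonal L 3 α w (z0 w ∘ ⇑(ρ₁ w))⟩ : archLocal L 3 (Matrix.diagonal α) w) = (⟨circleDiagonal 3 (z0 w ∘ ⇑(ρ₂ w)), circleDiagonal_mem_archLocal_diagonal L 3 α w (z0 w ∘ ⇑(ρ₂ w))⟩ : archLocal L 3 (Matrix.diagonal α) w) :=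
    conj_archPiEquivCM_apply_circleDiagonal_of_conj_archDiagTorus L α z0 ρ₁ ρ₂ Q hQ
  have hFm : ∀ w : {w : InfinitePlace L // IsComplex w}, Measurable (⇑(subgroupCongrHomeomorph (MulAut.conj ((archPiEquivCM 3 L (Matrix.diagonal α)) Q w) : archLocal L 3 (Matrix.diagonal α) w ≃* archLocal L 3 (Matrix.diagonal α) w) (Subgroup.centralizer ({(⟨circleDiagonal 3 (z0 w ∘ ⇑(ρ₁ w)), circleDiagonal_mem_archLocal_diagonal L 3 α w (z0 w ∘ ⇑(ρ₁ w))⟩ : archLocal L 3 (Matrix.diagonal α) w)} : Set (archLocal L 3 (Matrix.diagonal α) w))) (Subgroup.centralizer ({(⟨circleDiagonal 3 (z0 w ∘ ⇑(ρ₂ w)), circleDiagonal_mem_archLocal_diagonal L 3 α w (z0 w ∘ ⇑(ρ₂ w))⟩ : archLocal L 3 (Matrix.diagonal α) w)} : Set (archLocal L 3 (Matrix.diagonal α) w))) (forall_apply_mem_centralizer_singleton_iff_of_eq (MulAut.conj ((archPiEquivCM 3 L (Matrix.diagonal α)) Q w) : archLocal L 3 (Matrix.diagonal α) w ≃* archLocal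 L 3 (Matrix.diagonal α) w) (hQw w)) (continuous_mulAutConj ((archPiEquivCM 3 L (Matrix.diagonal α)) Q w)) (continuous_mulAutConj_symm ((archPiEquivCM 3 L (Matrix.diagonal α)) Q w)))) :=
    fun w => Homeomorph.measurable _
  have hFmeas : Measurable (fun (x : ∀ w : {w : InfinitePlace L // IsComplex w}, Subgroup.centralizer ({(⟨circleDiagonal 3 (z0 w ∘ ⇑(ρ₁ w)), circleDiagonal_mem_archLocal_diagonal L 3 α w (z0 w ∘ ⇑(ρ₁ w))⟩ : archLocal L 3 (Matrix.diagonal α) w)} : Set (archLocal L 3 (Matrix.diagonal α) w))) (w : {w : InfinitePlace L // IsComplex w}) =>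
      (subgroupCongrHomeomorph (MulAut.conj ((archPiEquivCM 3 L (Matrix.diagonal α)) Q w) : archLocal L 3 (Matrix.diagonal α) w ≃* archLocal L 3 (Matrix.diagonal α) w) (Subgroup.centralizer ({(⟨circleDiagonal 3 (z0 w ∘ ⇑(ρ₁ w)), circleDiagonal_mem_archLocal_diagonal L 3 α w (z0 w ∘ ⇑(ρ₁ w))⟩ : archLocal L 3 (Matrix.diagonal α) w)} : Set (archLocal L 3 (Matrix.diagonal α) w))) (Subgroup.centralizer ({(⟨circleDiagonal 3 (z0 w ∘ ⇑(ρ₂ w)), circleDiagonal_mem_archLocal_diagonal L 3 α w (z0 w ∘ ⇑(ρ₂ w))⟩ : archLocal L 3 (Matrix.diagonal α) w)} : Set (archLocal L 3 (Matrix.diagonal α) w))) (forall_apply_mem_centralizer_singleton_iff_of_eq (MulAut.conj ((archPiEquivCM 3 L (Matrix.diagonal α)) Q w) : archLocal L 3 (Matrix.diagonal α) w ≃* archLocal L 3 (Matrix.diagonal α) w) (hQw w)) (continuous_mulAutConj ((archPiEquivCM 3 L (Matrix.diagonal α)) Q w)) (continuous_mulAutConj_symm ((archPiEquivCM 3 L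 (Matrix.diagonal α)) Q w))) (x w)) :=
    measurable_pi_lambda _ (fun w => (hFm w).comp (measurable_pi_apply w))
  -- (1) the product side: per-place coherence and `Measure.pi_map_pi`
  have hpi : (Measure.pi fun w => ρZ w (ρ₁ w)).map (fun (x : ∀ w : {w : InfinitePlace L // IsComplex w}, Subgroup.centralizer ({(⟨circleDiagonal 3 (z0 w ∘ ⇑(ρ₁ w)), circleDiagonal_mem_archLocal_diagonal L 3 α w (z0 w ∘ ⇑(ρ₁ w))⟩ : archLocal L 3 (Matrix.diagonal α) w)} : Set (archLocal L 3 (Matrix.diagonal α) w))) (w : {w : InfinitePlace L // IsComplex w}) =>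
      (subgroupCongrHomeomorph (MulAut.conj ((archPiEquivCM 3 L (Matrix.diagonal α)) Q w) : archLocal L 3 (Matrix.diagonal α) w ≃* archLocal L 3 (Matrix.diagonal α) w) (Subgroup.centralizer ({(⟨circleDiagonal 3 (z0 w ∘ ⇑(ρ₁ w)), circleDiagonal_mem_archLocal_diagonal L 3 α w (z0 w ∘ ⇑(ρ₁ w))⟩ : archLocal L 3 (Matrix.diagonal α) w)} : Set (archLocal L 3 (Matrix.diagonal α) w))) (Subgroup.centralizer ({(⟨circleDiagonal 3 (z0 w ∘ ⇑(ρ₂ w)), circleDiagonal_mem_archLocal_diagonal L 3 α w (z0 w ∘ ⇑(ρ₂ w))⟩ : archLocal L 3 (Matrix.diagonal α) w)} : Set (archLocal L 3 (Matrix.diagonal α) w))) (forall_apply_mem_centralizer_singleton_iff_of_eq (MulAut.conj ((archPiEquivCM 3 L (Matrix.diagonal α)) Q w) : archLocal L 3 (Matrix.diagonal α) w ≃* archLocal L 3 (Matrix.diagonal α) w) (hQw w)) (continuous_mulAutConj ((archPiEquivCM 3 L (Matrix.diagonal α)) Q w)) (continuous_mulAutConj_symm ((archPiEquivCM 3 L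 (Matrix.diagonal α)) Q w))) (x w)) = Measure.pi fun w => ρZ w (ρ₂ w) := by
    haveI : ∀ w : {w : InfinitePlace L // IsComplex w}, SigmaFinite ((ρZ w (ρ₁ w)).map (⇑(subgroupCongrHomeomorph (MulAut.conj ((archPiEquivCM 3 L (Matrix.diagonal α)) Q w) : archLocal L 3 (Matrix.diagonal α) w ≃* archLocal L 3 (Matrix.diagonal α) w) (Subgroup.centralizer ({(⟨circleDiagonal 3 (z0 w ∘ ⇑(ρ₁ w)), circleDiagonal_mem_archLocal_diagonal L 3 α w (z0 w ∘ ⇑(ρ₁ w))⟩ : archLocal L 3 (Matrix.diagonal α) w)} : Set (archLocal L 3 (Matrix.diagonal α) w))) (Subgroup.centralizer ({(⟨circleDiagonal 3 (z0 w ∘ ⇑(ρ₂ w)), circleDiagonal_mem_archLocal_diagonal L 3 α w (z0 w ∘ ⇑(ρ₂ w))⟩ : archLocal L 3 (Matrix.diagonal α) w)} : Set (archLocal L 3 (Matrix.diagonal α) w))) (forall_apply_mem_centralizer_singleton_iff_of_eq (MulAut.conj ((archPiEquivCM 3 L (Matrix.diagonal α)) Q w) : archLocal L 3 (Matrix.diagonal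 α) w ≃* archLocal L 3 (Matrix.diagonal α) w) (hQw w)) (continuous_mulAutConj ((archPiEquivCM 3 L (Matrix.diagonal α)) Q w)) (continuous_mulAutConj_symm ((archPiEquivCM 3 L (Matrix.diagonal α)) Q w))))) := fun w => by
      rw [hcohw w (ρ₁ w) (ρ₂ w) _ (hQw w)]; infer_instance
    rw [Measure.pi_map_pi (fun w => (hFm w).aemeasurable)]
    exact congrArg Measure.pi (funext fun w => hcohw w (ρ₁ w) (ρ₂ w) _ (hQw w))
  -- (2) abstract bookkeeping: in coordinates the composite `E₂⁻¹ ∘ conj Q ∘ E₁` IS the componentwise conjugation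
  simp only [hρ']
  refine map_map_eq_map_of_coords (Homeomorph.measurable _) (Homeomorph.measurable _) (Homeomorph.measurable _)
    (E₂' := ⇑(subgroupCongrHomeomorph (archPiEquivCM 3 L (Matrix.diagonal α)).symm.toMulEquiv (Subgroup.pi Set.univ (fun w : {w : InfinitePlace L // IsComplex w} => Subgroup.centralizer ({(⟨circleDiagonal 3 (z0 w ∘ ⇑(ρ₂ w)), circleDiagonal_mem_archLocal_diagonal L 3 α w (z0 w ∘ ⇑(ρ₂ w))⟩ : archLocal L 3 (Matrix.diagonal α) w)} : Set (archLocal L 3 (Matrix.diagonal α) w)))) (Subgroup.centralizer ({archDiagTorus L 3 α (fun w => z0 w ∘ ⇑(ρ₂ w))} : Set (arch (↥(maximalRealSubfield L)) L (IsCMField.complexConj L) 3 (Matrix.diagonal α)))) (apply_mem_centralizer_iff_mem_pi_centralizer _ (archPiEquivCM 3 L (Matrix.diagonal α)).symm.toMulEquiv (archPiEquivCM_symm_circleDiagonal_eq_archDiagTorus L 3 α (fun w => z0 w ∘ ⇑(ρ₂ w)))) (archPiEquivCM 3 L (Matrix.diagonal α)).symm.continuous (archPiEquivCM 3 L (Matrix.diagonal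 α)).continuous).symm)
    (Homeomorph.measurable _) (fun z => Homeomorph.apply_symm_apply _ z)
    (e₁ := ⇑(subgroupPiCoords fun w : {w : InfinitePlace L // IsComplex w} => Subgroup.centralizer ({(⟨circleDiagonal 3 (z0 w ∘ ⇑(ρ₁ w)), circleDiagonal_mem_archLocal_diagonal L 3 α w (z0 w ∘ ⇑(ρ₁ w))⟩ : archLocal L 3 (Matrix.diagonal α) w)} : Set (archLocal L 3 (Matrix.diagonal α) w)))) (e₂ := ⇑(subgroupPiCoords fun w : {w : InfinitePlace L // IsComplex w} => Subgroup.centralizer ({(⟨circleDiagonal 3 (z0 w ∘ ⇑(ρ₂ w)), circleDiagonal_mem_archLocal_diagonal L 3 α w (z0 w ∘ ⇑(ρ₂ w))⟩ : archLocal L 3 (Matrix.diagonal α) w)} : Set (archLocal L 3 (Matrix.diagonal α) w)))) (e₂' := ⇑(subgroupPiCoords fun w : {w : InfinitePlace L // IsComplex w} => Subgroup.centralizer ({(⟨circleDiagonal 3 (z0 w ∘ ⇑(ρ₂ w)), circleDiagonal_mem_archLocal_diagonal L 3 α w (z0 w ∘ ⇑(ρ₂ w))⟩ : archLocal L 3 (Matrix.diagonal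 α) w)} : Set (archLocal L 3 (Matrix.diagonal α) w))).symm)
    he₁c.measurable he₂c.measurable he₂sc.measurable (fun x => MulEquiv.symm_apply_apply _ x) hFmeas (fun x => ?_) ?_
  · -- pointwise, place by place
    have hs : ((archPiEquivCM 3 L (Matrix.diagonal α)).symm.toMulEquiv).symm = (archPiEquivCM 3 L (Matrix.diagonal α)).toMulEquiv := rfl
    funext w
    apply Subtype.ext
    simp only [coe_subgroupPiCoords_apply, coe_subgroupCongrHomeomorph_apply, coe_subgroupCongrHomeomorph_symm_apply, MulAut.conj_apply, hs, map_mul, map_inv,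
      Pi.mul_apply, Pi.inv_apply]
    exact congrArg (fun y : (∀ w : {w : InfinitePlace L // IsComplex w}, archLocal L 3 (Matrix.diagonal α) w) => (archPiEquivCM 3 L (Matrix.diagonal α)) Q w * y w * ((archPiEquivCM 3 L (Matrix.diagonal α)) Q w)⁻¹) ((archPiEquivCM 3 L (Matrix.diagonal α)).apply_symm_apply _)
  · rw [hρP ρ₁, hpi, hρP ρ₂]

end Abstract

section Abstract

variable [∀ w : {w : InfinitePlace L // IsComplex w}, MeasurableSpace (archLocal L 3 (Matrix.diagonal α) w)] [∀ w : {w : InfinitePlace L // IsComplex w}, BorelSpace (archLocal L 3 (Matrix.diagonal α) w)]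
  [iSC : ∀ w : {w : InfinitePlace L // IsComplex w}, SecondCountableTopology (archLocal L 3 (Matrix.diagonal α) w)] [iLC : ∀ w : {w : InfinitePlace L // IsComplex w}, LocallyCompactSpace (archLocal L 3 (Matrix.diagonal α) w)]

/-- **(W3) THE COHERENT PINNED TELESCOPE — the ∃-package the (ST-∞) END consumes.**  From per-place Haar inversion-invariant centraliser families `ρZ_w(σ)` on the
`Z_w(diag(z⁰_w∘σ))`, coherent under `G_w(α)`-conjugation at every place, there are: the telescope `ρP`, `ρ′` with ★ (D5)'s binders `hρPi`, `hρP`, `hρ′i`, `hρ′` VERBATIM (★ (W2)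
`exists_pi_centralizer_measures` at every `ρ`), and a torus datum `T` on `U(diag α)(L⁺ ⊗ ℝ)` which restricts to `ρ′` at the wall torus points `t(z⁰∘ρ)`, is a conjugation transport
of some `ρ′ ρ` — hence Haar and inversion invariant — at every point of the wall classes `{q t(z⁰∘ρ) q⁻¹}`, and is COHERENT UNDER EVERY CONJUGATOR there (§2 + §1).  For an orbital
measure family `m` with `m.IsQuotientOf (fun γ => ∃ ρ q, q t(z⁰∘ρ) q⁻¹ = γ) ν_∞ T`, ★ `IsQuotientOf.atPoint_eq_quotientMeasure_of_forall_map_conj_eq` then yields (D5)'s `hq` at every `ρ`.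
[cite: Rogawski1990, §1.7 p. 6; §4.3 (4.3.1) p. 43; §8.2 pp. 122–124] [cite: DeitmarEchterhoff2014, Thm. 1.5.3] [cite: Folland1995, §2.6 (2.52)] -/
theorem exists_conj_coherent_pinned_telescope (z0 : {w : InfinitePlace L // IsComplex w} → Fin 3 → Circle)
    (ρZ : ∀ (w : {w : InfinitePlace L // IsComplex w}) (σ : Perm (Fin 3)), Measure (Subgroup.centralizer ({(⟨circleDiagonal 3 (z0 w ∘ ⇑σ), circleDiagonal_mem_archLocal_diagonal L 3 α w (z0 w ∘ ⇑σ)⟩ : archLocal L 3 (Matrix.diagonal α) w)} : Set (archLocal L 3 (Matrix.diagonal α) w))))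
    (hρZi : ∀ w σ, (ρZ w σ).IsHaarMeasure ∧ (ρZ w σ).IsInvInvariant)
    (hcohw : ∀ (w : {w : InfinitePlace L // IsComplex w}) (σ₁ σ₂ : Perm (Fin 3)) (g : archLocal L 3 (Matrix.diagonal α) w) (hg : (MulAut.conj g : archLocal L 3 (Matrix.diagonal α) w ≃* archLocal L 3 (Matrix.diagonal α) w) (⟨circleDiagonal 3 (z0 w ∘ ⇑σ₁), circleDiagonal_mem_archLocal_diagonal L 3 α w (z0 w ∘ ⇑σ₁)⟩ : archLocal L 3 (Matrix.diagonal α) w) = (⟨circleDiagonal 3 (z0 w ∘ ⇑σ₂), circleDiagonal_mem_archLocal_diagonal L 3 α w (z0 w ∘ ⇑σ₂)⟩ : archLocal L 3 (Matrix.diagonal α) w)),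
      (ρZ w σ₁).map (subgroupCongrHomeomorph (MulAut.conj g : archLocal L 3 (Matrix.diagonal α) w ≃* archLocal L 3 (Matrix.diagonal α) w) (Subgroup.centralizer ({(⟨circleDiagonal 3 (z0 w ∘ ⇑σ₁), circleDiagonal_mem_archLocal_diagonal L 3 α w (z0 w ∘ ⇑σ₁)⟩ : archLocal L 3 (Matrix.diagonal α) w)} : Set (archLocal L 3 (Matrix.diagonal α) w))) (Subgroup.centralizer ({(⟨circleDiagonal 3 (z0 w ∘ ⇑σ₂), circleDiagonal_mem_archLocal_diagonal L 3 α w (z0 w ∘ ⇑σ₂)⟩ : archLocal L 3 (Matrix.diagonal α) w)} : Set (archLocal L 3 (Matrix.diagonal α) w))) (forall_apply_mem_centralizer_singleton_iff_of_eq (MulAut.conj g : archLocal L 3 (Matrix.diagonal α) w ≃* archLocal L 3 (Matrix.diagonal α) w) hg) (continuous_mulAutConj g) (continuous_mulAutConj_symm g)) = ρZ w σ₂) :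
    ∃ (ρP : ∀ ρ : {w : InfinitePlace L // IsComplex w} → Perm (Fin 3), Measure (Subgroup.pi Set.univ (fun w : {w : InfinitePlace L // IsComplex w} => Subgroup.centralizer ({(⟨circleDiagonal 3 (z0 w ∘ ⇑(ρ w)), circleDiagonal_mem_archLocal_diagonal L 3 α w (z0 w ∘ ⇑(ρ w))⟩ : archLocal L 3 (Matrix.diagonal α) w)} : Set (archLocal L 3 (Matrix.diagonal α) w)))))
      (ρ' : ∀ ρ : {w : InfinitePlace L // IsComplex w} → Perm (Fin 3), Measure (Subgroup.centralizer ({archDiagTorus L 3 α (fun w => z0 w ∘ ⇑(ρ w))} : Set (arch (↥(maximalRealSubfield L)) L (IsCMField.complexConj L) 3 (Matrix.diagonal α)))))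
      (T : ∀ γ : arch (↥(maximalRealSubfield L)) L (IsCMField.complexConj L) 3 (Matrix.diagonal α), Measure (Subgroup.centralizer ({γ} : Set (arch (↥(maximalRealSubfield L)) L (IsCMField.complexConj L) 3 (Matrix.diagonal α))))),
      (∀ ρ, (ρP ρ).IsHaarMeasure ∧ (ρP ρ).IsInvInvariant) ∧
      (∀ ρ : {w : InfinitePlace L // IsComplex w} → Perm (Fin 3), Measure.map (subgroupPiCoords fun w : {w : InfinitePlace L // IsComplex w} => Subgroup.centralizer ({(⟨circleDiagonal 3 (z0 w ∘ ⇑(ρ w)), circleDiagonal_mem_archLocal_diagonal L 3 α w (z0 w ∘ ⇑(ρ w))⟩ : archLocal L 3 (Matrix.diagonal α) w)} : Set (archLocal L 3 (Matrix.diagonal α) w))) (ρP ρ) = Measure.pi fun w => ρZ w (ρ w)) ∧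
      (∀ ρ, (ρ' ρ).IsHaarMeasure ∧ (ρ' ρ).IsInvInvariant) ∧
      (∀ ρ : {w : InfinitePlace L // IsComplex w} → Perm (Fin 3), ρ' ρ = (ρP ρ).map (subgroupCongrHomeomorph (archPiEquivCM 3 L (Matrix.diagonal α)).symm.toMulEquiv (Subgroup.pi Set.univ (fun w : {w : InfinitePlace L // IsComplex w} => Subgroup.centralizer ({(⟨circleDiagonal 3 (z0 w ∘ ⇑(ρ w)), circleDiagonal_mem_archLocal_diagonal L 3 α w (z0 w ∘ ⇑(ρ w))⟩ : archLocal L 3 (Matrix.diagonal α) w)} : Set (archLocal L 3 (Matrix.diagonal α) w)))) (Subgroup.centralizer ({archDiagTorus L 3 α (fun w => z0 w ∘ ⇑(ρ w))} : Set (arch (↥(maximalRealSubfield L)) L (IsCMField.complexConj L) 3 (Matrix.diagonal α)))) (apply_mem_centralizer_iff_mem_pi_centralizer _ (archPiEquivCM 3 L (Matrix.diagonal α)).symm.toMulEquiv (archPiEquivCM_symm_circleDiagonal_eq_archDiagTorus L 3 α (fun w => z0 w ∘ ⇑(ρ w)))) (archPiEquivCM 3 L (Matrix.diagonal α)).symm.continuous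 (archPiEquivCM 3 L (Matrix.diagonal α)).continuous)) ∧
      (∀ ρ : {w : InfinitePlace L // IsComplex w} → Perm (Fin 3), T (archDiagTorus L 3 α (fun w => z0 w ∘ ⇑(ρ w))) = ρ' ρ) ∧
      (∀ γ : arch (↥(maximalRealSubfield L)) L (IsCMField.complexConj L) 3 (Matrix.diagonal α), (∃ (ρ : {w : InfinitePlace L // IsComplex w} → Perm (Fin 3)) (q : arch (↥(maximalRealSubfield L)) L (IsCMField.complexConj L) 3 (Matrix.diagonal α)), (MulAut.conj q : arch (↥(maximalRealSubfield L)) L (IsCMField.complexConj L) 3 (Matrix.diagonal α) ≃* arch (↥(maximalRealSubfield L)) L (IsCMField.complexConj L) 3 (Matrix.diagonal α)) (archDiagTorus L 3 α (fun w => z0 w ∘ ⇑(ρ w))) = γ) →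
        ∃ (ρ : {w : InfinitePlace L // IsComplex w} → Perm (Fin 3)) (q : arch (↥(maximalRealSubfield L)) L (IsCMField.complexConj L) 3 (Matrix.diagonal α)) (h : (MulAut.conj q : arch (↥(maximalRealSubfield L)) L (IsCMField.complexConj L) 3 (Matrix.diagonal α) ≃* arch (↥(maximalRealSubfield L)) L (IsCMField.complexConj L) 3 (Matrix.diagonal α)) (archDiagTorus L 3 α (fun w => z0 w ∘ ⇑(ρ w))) = γ), T γ = (ρ' ρ).map (subgroupCongrHomeomorph (MulAut.conj q : arch (↥(maximalRealSubfield L)) L (IsCMField.complexConj L) 3 (Matrix.diagonal α) ≃* arch (↥(maximalRealSubfield L)) L (IsCMField.complexConj L) 3 (Matrix.diagonal α)) (Subgroup.centralizer ({archDiagTorus L 3 α (fun w => z0 w ∘ ⇑(ρ w))} : Set (arch (↥(maximalRealSubfield L)) L (IsCMField.complexConj L) 3 (Matrix.diagonal α)))) (Subgroup.centralizer ({γ} : Set (arch (↥(maximalRealSubfield L)) L (IsCMField.complexConj L) 3 (Matrix.diagonal α)))) (forall_apply_mem_centralizer_singleton_iff_of_eq (MulAut.conj q : arch (↥(maximalRealSubfield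 L)) L (IsCMField.complexConj L) 3 (Matrix.diagonal α) ≃* arch (↥(maximalRealSubfield L)) L (IsCMField.complexConj L) 3 (Matrix.diagonal α)) h) (continuous_mulAutConj q) (continuous_mulAutConj_symm q))) ∧
      (∀ γ : arch (↥(maximalRealSubfield L)) L (IsCMField.complexConj L) 3 (Matrix.diagonal α), (∃ (ρ : {w : InfinitePlace L // IsComplex w} → Perm (Fin 3)) (q : arch (↥(maximalRealSubfield L)) L (IsCMField.complexConj L) 3 (Matrix.diagonal α)), (MulAut.conj q : arch (↥(maximalRealSubfield L)) L (IsCMField.complexConj L) 3 (Matrix.diagonal α) ≃* arch (↥(maximalRealSubfield L)) L (IsCMField.complexConj L) 3 (Matrix.diagonal α)) (archDiagTorus L 3 α (fun w => z0 w ∘ ⇑(ρ w))) = γ) → (T γ).IsHaarMeasure ∧ (T γ).IsInvInvariant) ∧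
      ∀ (γ₁ γ₂ Q : arch (↥(maximalRealSubfield L)) L (IsCMField.complexConj L) 3 (Matrix.diagonal α)) (hQ : (MulAut.conj Q : arch (↥(maximalRealSubfield L)) L (IsCMField.complexConj L) 3 (Matrix.diagonal α) ≃* arch (↥(maximalRealSubfield L)) L (IsCMField.complexConj L) 3 (Matrix.diagonal α)) γ₁ = γ₂), (∃ (ρ : {w : InfinitePlace L // IsComplex w} → Perm (Fin 3)) (q : arch (↥(maximalRealSubfield L)) L (IsCMField.complexConj L) 3 (Matrix.diagonal α)), (MulAut.conj q : arch (↥(maximalRealSubfield L)) L (IsCMField.complexConj L) 3 (Matrix.diagonal α) ≃* arch (↥(maximalRealSubfield L)) L (IsCMField.complexConj L) 3 (Matrix.diagonal α)) (archDiagTorus L 3 α (fun w => z0 w ∘ ⇑(ρ w))) = γ₁) →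
        (T γ₁).map (subgroupCongrHomeomorph (MulAut.conj Q : arch (↥(maximalRealSubfield L)) L (IsCMField.complexConj L) 3 (Matrix.diagonal α) ≃* arch (↥(maximalRealSubfield L)) L (IsCMField.complexConj L) 3 (Matrix.diagonal α)) (Subgroup.centralizer ({γ₁} : Set (arch (↥(maximalRealSubfield L)) L (IsCMField.complexConj L) 3 (Matrix.diagonal α)))) (Subgroup.centralizer ({γ₂} : Set (arch (↥(maximalRealSubfield L)) L (IsCMField.complexConj L) 3 (Matrix.diagonal α)))) (forall_apply_mem_centralizer_singleton_iff_of_eq (MulAut.conj Q : arch (↥(maximalRealSubfield L)) L (IsCMField.complexConj L) 3 (Matrix.diagonal α) ≃* arch (↥(maximalRealSubfield L)) L (IsCMField.complexConj L) 3 (Matrix.diagonal α)) hQ) (continuous_mulAutConj Q) (continuous_mulAutConj_symm Q)) = T γ₂ := by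
  -- the telescope at every `ρ`: ★ (W2)
  have hW2 := fun ρ : {w : InfinitePlace L // IsComplex w} → Perm (Fin 3) =>
    exists_pi_centralizer_measures L 3 α (fun w => z0 w ∘ ⇑(ρ w)) (fun w => ρZ w (ρ w)) (fun w => hρZi w (ρ w))
  choose ρP ρ' hρPi hρP hρ'i hρ' using hW2
  -- global coherence of `ρ′` between the wall torus points (§2)
  have hcoh' : ∀ (ρ₁ ρ₂ : {w : InfinitePlace L // IsComplex w} → Perm (Fin 3)) (Q : arch (↥(maximalRealSubfield L)) L (IsCMField.complexConj L) 3 (Matrix.diagonal α)) (hQ : (MulAut.conj Q : arch (↥(maximalRealSubfield L)) L (IsCMField.complexConj L) 3 (Matrix.diagonal α) ≃* arch (↥(maximalRealSubfield L)) L (IsCMField.complexConj L) 3 (Matrix.diagonal α)) (archDiagTorus L 3 α (fun w => z0 w ∘ ⇑(ρ₁ w))) = archDiagTorus L 3 α (fun w => z0 w ∘ ⇑(ρ₂ w))),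
      (ρ' ρ₁).map (subgroupCongrHomeomorph (MulAut.conj Q : arch (↥(maximalRealSubfield L)) L (IsCMField.complexConj L) 3 (Matrix.diagonal α) ≃* arch (↥(maximalRealSubfield L)) L (IsCMField.complexConj L) 3 (Matrix.diagonal α)) (Subgroup.centralizer ({archDiagTorus L 3 α (fun w => z0 w ∘ ⇑(ρ₁ w))} : Set (arch (↥(maximalRealSubfield L)) L (IsCMField.complexConj L) 3 (Matrix.diagonal α)))) (Subgroup.centralizer ({archDiagTorus L 3 α (fun w => z0 w ∘ ⇑(ρ₂ w))} : Set (arch (↥(maximalRealSubfield L)) L (IsCMField.complexConj L) 3 (Matrix.diagonal α)))) (forall_apply_mem_centralizer_singleton_iff_of_eq (MulAut.conj Q : arch (↥(maximalRealSubfield L)) L (IsCMField.complexConj L) 3 (Matrix.diagonal α) ≃* arch (↥(maximalRealSubfield L)) L (IsCMField.complexConj L) 3 (Matrix.diagonal α)) hQ) (continuous_mulAutConj Q) (continuous_mulAutConj_symm Q)) = ρ' ρ₂ :=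
    fun ρ₁ ρ₂ Q hQ => centralizer_pi_measure_conj_coherent L α z0 ρZ hρZi hcohw ρP hρP ρ' hρ' ρ₁ ρ₂ Q hQ
  -- extension by choice along conjugators (§1)
  obtain ⟨T, hTb, hTpres, hTcoh⟩ := Literature.NumberTheory.Automorphic.exists_conj_coherent_centralizer_family_of_base
    (fun ρ : {w : InfinitePlace L // IsComplex w} → Perm (Fin 3) => archDiagTorus L 3 α (fun w => z0 w ∘ ⇑(ρ w))) ρ' hcoh'
  refine ⟨ρP, ρ', T, hρPi, hρP, hρ'i, hρ', hTb, hTpres, fun γ hγ => ?_, hTcoh⟩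
  -- Haar and inversion invariance on the wall classes: a transport of some `ρ′ ρ`
  obtain ⟨ρ, q, h, hT⟩ := hTpres γ hγ
  haveI := (hρ'i ρ).1
  haveI := (hρ'i ρ).2
  haveI : LocallyCompactSpace (Subgroup.centralizer ({archDiagTorus L 3 α (fun w => z0 w ∘ ⇑(ρ w))} : Set (arch (↥(maximalRealSubfield L)) L (IsCMField.complexConj L) 3 (Matrix.diagonal α)))) := (isClosed_coe_centralizer_singleton _).isClosedEmbedding_subtypeVal.locallyCompactSpace
  rw [hT]
  exact ⟨isHaarMeasure_map_subgroupCongrHomeomorph _ _ _ _ _ _ (ρ' ρ), isInvInvariant_map_subgroupCongrHomeomorph _ _ _ _ _ _ (ρ' ρ)⟩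

end Abstract

/-! ## §4 The per-place coherence discharged by ★ C3: the (ST-∞) witness's actual pins -/

section Pins

variable [MeasurableSpace (GL (Fin 3) ℂ)] [BorelSpace (GL (Fin 3) ℂ)]

/-- **(W3) FOR THE ACTUAL PINS.**  §3 with `hcohw` discharged by ★ C3 `centralizer_measure_family_conj_coherent` at every place, i.e. over ★ (D5)'s binders `νH hνH ρZ hρZi hρZ`
VERBATIM (frame `α` real at every complex place, wall point `z⁰` and reference wall point `z₁` per place), the within-place links (T02)∕(T01) of the reference measures (★
`centralizer_measure_links_of_clause_neg_one`'s outputs, from the self-normalising pin) and PROBABILITY mass at the compact walls (`hρZ1`; so (D5)'s `hM` holds with `M v = 1`).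
Output: `ρP ρ′ T` with (D5)'s `hρPi hρP hρ′i hρ′`, `T (t(z⁰∘ρ)) = ρ′ ρ`, and the `hcoh` of ★ `IsQuotientOf.atPoint_eq_quotientMeasure_of_forall_map_conj_eq` on the wall classes.
[cite: Rogawski1990, §1.7 p. 6; §4.3 (4.3.1) p. 43; §8.2 pp. 122–124; §14.5 p. 238] [cite: DeitmarEchterhoff2014, Thm. 1.5.3] -/
theorem exists_conj_coherent_pinned_telescope_of_links
    (hα : ∀ i, α i ≠ 0) (hreal : ∀ (w : {w : InfinitePlace L // IsComplex w}) (i : Fin 3), (w.1.embedding (α i)).im = 0)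
    (z0 : {w : InfinitePlace L // IsComplex w} → Fin 3 → Circle) (hwall : ∀ w, z0 w 0 = z0 w 2 ∧ z0 w 0 ≠ z0 w 1)
    (z₁ : {w : InfinitePlace L // IsComplex w} → Fin 3 → Circle) (h02 : ∀ w, z₁ w 0 = z₁ w 2) (h01 : ∀ w, z₁ w 0 ≠ z₁ w 1)
    (νH : ∀ (w : {w : InfinitePlace L // IsComplex w}) (τ : Perm (Fin 3)), Measure (Subgroup.centralizer ({(⟨circleDiagonal 3 (z₁ w), circleDiagonal_mem_archLocal_diagonal L 3 (α ∘ ⇑τ) w (z₁ w)⟩ : archLocal L 3 (Matrix.diagonal (α ∘ ⇑τ)) w)} : Set (archLocal L 3 (Matrix.diagonal (α ∘ ⇑τ)) w))))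
    (hT02 : ∀ (w : {w : InfinitePlace L // IsComplex w}) (τ : Perm (Fin 3)), (w.1.embedding (α (τ 0))).re * (w.1.embedding (α (τ 2))).re < 0 →
      νH w τ = (νH w (τ * Equiv.swap (0 : Fin 3) 2)).map (subgroupCongrHomeomorph (ContinuousMulEquiv.restrictSubgroup (GLn.conjEquiv (Matrix.GeneralLinearGroup.mkOfDetNeZero _ (det_monomial_one_ne_zero 3 (Equiv.swap (0 : Fin 3) 2)))) (archLocal L 3 (Matrix.diagonal ((α ∘ ⇑τ) ∘ ⇑(Equiv.swap (0 : Fin 3) 2))) w) (archLocal L 3 (Matrix.diagonal (α ∘ ⇑τ)) w) (mem_archLocal_comp_perm_iff_conj_mem L 3 (α ∘ ⇑τ) w (Equiv.swap (0 : Fin 3) 2))).toMulEquiv (Subgroup.centralizer ({(⟨circleDiagonal 3 (z₁ w), circleDiagonal_mem_archLocal_diagonal L 3 ((α ∘ ⇑τ) ∘ ⇑(Equiv.swap (0 : Fin 3) 2)) w (z₁ w)⟩ : archLocal L 3 (Matrix.diagonal ((α ∘ ⇑τ) ∘ ⇑(Equiv.swap (0 : Fin 3) 2))) w)} : Set (archLocal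 L 3 (Matrix.diagonal ((α ∘ ⇑τ) ∘ ⇑(Equiv.swap (0 : Fin 3) 2))) w))) (Subgroup.centralizer ({(⟨circleDiagonal 3 (z₁ w), circleDiagonal_mem_archLocal_diagonal L 3 (α ∘ ⇑τ) w (z₁ w)⟩ : archLocal L 3 (Matrix.diagonal (α ∘ ⇑τ)) w)} : Set (archLocal L 3 (Matrix.diagonal (α ∘ ⇑τ)) w))) (forall_apply_mem_centralizer_singleton_iff_of_eq (ContinuousMulEquiv.restrictSubgroup (GLn.conjEquiv (Matrix.GeneralLinearGroup.mkOfDetNeZero _ (det_monomial_one_ne_zero 3 (Equiv.swap (0 : Fin 3) 2)))) (archLocal L 3 (Matrix.diagonal ((α ∘ ⇑τ) ∘ ⇑(Equiv.swap (0 : Fin 3) 2))) w) (archLocal L 3 (Matrix.diagonal (α ∘ ⇑τ)) w) (mem_archLocal_comp_perm_iff_conj_mem L 3 (α ∘ ⇑τ) w (Equiv.swap (0 : Fin 3) 2))).toMulEquiv ((relabel_circleDiagonal L 3 (α ∘ ⇑τ) w (Equiv.swap (0 : Fin 3) 2) (z₁ w)).trans (Subtype.ext (congrArg (circleDiagonal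 3) (comp_swap02_symm_eq_self_of_wall (z₁ w) (h02 w)))))) (ContinuousMulEquiv.restrictSubgroup (GLn.conjEquiv (Matrix.GeneralLinearGroup.mkOfDetNeZero _ (det_monomial_one_ne_zero 3 (Equiv.swap (0 : Fin 3) 2)))) (archLocal L 3 (Matrix.diagonal ((α ∘ ⇑τ) ∘ ⇑(Equiv.swap (0 : Fin 3) 2))) w) (archLocal L 3 (Matrix.diagonal (α ∘ ⇑τ)) w) (mem_archLocal_comp_perm_iff_conj_mem L 3 (α ∘ ⇑τ) w (Equiv.swap (0 : Fin 3) 2))).continuous (ContinuousMulEquiv.restrictSubgroup (GLn.conjEquiv (Matrix.GeneralLinearGroup.mkOfDetNeZero _ (det_monomial_one_ne_zero 3 (Equiv.swap (0 : Fin 3) 2)))) (archLocal L 3 (Matrix.diagonal ((α ∘ ⇑τ) ∘ ⇑(Equiv.swap (0 : Fin 3) 2))) w) (archLocal L 3 (Matrix.diagonal (α ∘ ⇑τ)) w) (mem_archLocal_comp_perm_iff_conj_mem L 3 (α ∘ ⇑τ) w (Equiv.swap (0 : Fin 3) 2))).symm.continuous))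
    (hT01 : ∀ (w : {w : InfinitePlace L // IsComplex w}) (τ : Perm (Fin 3)), (w.1.embedding (α (τ 0))).re * (w.1.embedding (α (τ 2))).re < 0 →
      ∀ (h01s : 0 < (w.1.embedding ((α ∘ ⇑τ) 0)).re * (w.1.embedding ((α ∘ ⇑τ) 1)).re),
      νH w (τ * Equiv.swap (0 : Fin 3) 1) = (νH w τ).map (subgroupCongrHomeomorph (ContinuousMulEquiv.restrictSubgroup (GLn.conjEquiv (Matrix.GeneralLinearGroup.mkOfDetNeZero (Matrix.diagonal ![((Real.sqrt ((w.1.embedding ((α ∘ ⇑τ) 0)).re / (w.1.embedding ((α ∘ ⇑τ) 1)).re) : ℝ) : ℂ), ((Real.sqrt ((w.1.embedding ((α ∘ ⇑τ) 1)).re / (w.1.embedding ((α ∘ ⇑τ) 0)).re) : ℝ) : ℂ), 1]) (det_rescale01_ne_zero h01s))) (archLocal L 3 (Matrix.diagonal (α ∘ ⇑τ)) w) (archLocal L 3 (Matrix.diagonal ((α ∘ ⇑τ) ∘ ⇑(Equiv.swap (0 : Fin 3) 1))) w) (mem_archLocal_diagonal_iff_conjEquiv_mem_of_formCongr_eq L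 3 (α ∘ ⇑τ) ((α ∘ ⇑τ) ∘ ⇑(Equiv.swap (0 : Fin 3) 1)) w (Matrix.GeneralLinearGroup.mkOfDetNeZero (Matrix.diagonal ![((Real.sqrt ((w.1.embedding ((α ∘ ⇑τ) 0)).re / (w.1.embedding ((α ∘ ⇑τ) 1)).re) : ℝ) : ℂ), ((Real.sqrt ((w.1.embedding ((α ∘ ⇑τ) 1)).re / (w.1.embedding ((α ∘ ⇑τ) 0)).re) : ℝ) : ℂ), 1]) (det_rescale01_ne_zero h01s)) (formCongr_rescale01_map_diagonal L (α ∘ ⇑τ) w (fun i => hreal w (τ i)) h01s))).toMulEquiv (Subgroup.centralizer ({(⟨circleDiagonal 3 (z₁ w), circleDiagonal_mem_archLocal_diagonal L 3 (α ∘ ⇑τ) w (z₁ w)⟩ : archLocal L 3 (Matrix.diagonal (α ∘ ⇑τ)) w)} : Set (archLocal L 3 (Matrix.diagonal (α ∘ ⇑τ)) w))) (Subgroup.centralizer ({(⟨circleDiagonal 3 (z₁ w), circleDiagonal_mem_archLocal_diagonal L 3 ((α ∘ ⇑τ) ∘ ⇑(Equiv.swap (0 : Fin 3) 1)) w (z₁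 w)⟩ : archLocal L 3 (Matrix.diagonal ((α ∘ ⇑τ) ∘ ⇑(Equiv.swap (0 : Fin 3) 1))) w)} : Set (archLocal L 3 (Matrix.diagonal ((α ∘ ⇑τ) ∘ ⇑(Equiv.swap (0 : Fin 3) 1))) w))) (forall_apply_mem_centralizer_singleton_iff_of_eq (ContinuousMulEquiv.restrictSubgroup (GLn.conjEquiv (Matrix.GeneralLinearGroup.mkOfDetNeZero (Matrix.diagonal ![((Real.sqrt ((w.1.embedding ((α ∘ ⇑τ) 0)).re / (w.1.embedding ((α ∘ ⇑τ) 1)).re) : ℝ) : ℂ), ((Real.sqrt ((w.1.embedding ((α ∘ ⇑τ) 1)).re / (w.1.embedding ((α ∘ ⇑τ) 0)).re) : ℝ) : ℂ), 1]) (det_rescale01_ne_zero h01s))) (archLocal L 3 (Matrix.diagonal (α ∘ ⇑τ)) w) (archLocal L 3 (Matrix.diagonal ((α ∘ ⇑τ) ∘ ⇑(Equiv.swap (0 : Fin 3) 1))) w) (mem_archLocal_diagonal_iff_conjEquiv_mem_of_formCongr_eq L 3 (α ∘ ⇑τ) ((α ∘ ⇑τ) ∘ ⇑(Equiv.swap (0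 : Fin 3) 1)) w (Matrix.GeneralLinearGroup.mkOfDetNeZero (Matrix.diagonal ![((Real.sqrt ((w.1.embedding ((α ∘ ⇑τ) 0)).re / (w.1.embedding ((α ∘ ⇑τ) 1)).re) : ℝ) : ℂ), ((Real.sqrt ((w.1.embedding ((α ∘ ⇑τ) 1)).re / (w.1.embedding ((α ∘ ⇑τ) 0)).re) : ℝ) : ℂ), 1]) (det_rescale01_ne_zero h01s)) (formCongr_rescale01_map_diagonal L (α ∘ ⇑τ) w (fun i => hreal w (τ i)) h01s))).toMulEquiv (congrT_circleDiagonal L 3 (α ∘ ⇑τ) ((α ∘ ⇑τ) ∘ ⇑(Equiv.swap (0 : Fin 3) 1)) w (Matrix.GeneralLinearGroup.mkOfDetNeZero (Matrix.diagonal ![((Real.sqrt ((w.1.embedding ((α ∘ ⇑τ) 0)).re / (w.1.embedding ((α ∘ ⇑τ) 1)).re) : ℝ) : ℂ), ((Real.sqrt ((w.1.embedding ((α ∘ ⇑τ) 1)).re / (w.1.embedding ((α ∘ ⇑τ) 0)).re) : ℝ) : ℂ), 1]) (det_rescale01_ne_zero h01s)) (formCongr_rescale01_map_diagonal L (α ∘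 ⇑τ) w (fun i => hreal w (τ i)) h01s) (rescale01_conj_circleDiagonal L (α ∘ ⇑τ) w h01s) (z₁ w))) (ContinuousMulEquiv.restrictSubgroup (GLn.conjEquiv (Matrix.GeneralLinearGroup.mkOfDetNeZero (Matrix.diagonal ![((Real.sqrt ((w.1.embedding ((α ∘ ⇑τ) 0)).re / (w.1.embedding ((α ∘ ⇑τ) 1)).re) : ℝ) : ℂ), ((Real.sqrt ((w.1.embedding ((α ∘ ⇑τ) 1)).re / (w.1.embedding ((α ∘ ⇑τ) 0)).re) : ℝ) : ℂ), 1]) (det_rescale01_ne_zero h01s))) (archLocal L 3 (Matrix.diagonal (α ∘ ⇑τ)) w) (archLocal L 3 (Matrix.diagonal ((α ∘ ⇑τ) ∘ ⇑(Equiv.swap (0 : Fin 3) 1))) w) (mem_archLocal_diagonal_iff_conjEquiv_mem_of_formCongr_eq L 3 (α ∘ ⇑τ) ((α ∘ ⇑τ) ∘ ⇑(Equiv.swap (0 : Fin 3) 1)) w (Matrix.GeneralLinearGroup.mkOfDetNeZero (Matrix.diagonal ![((Real.sqrt ((w.1.embedding ((α ∘ ⇑τ) 0)).re / (w.1.embedding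 ((α ∘ ⇑τ) 1)).re) : ℝ) : ℂ), ((Real.sqrt ((w.1.embedding ((α ∘ ⇑τ) 1)).re / (w.1.embedding ((α ∘ ⇑τ) 0)).re) : ℝ) : ℂ), 1]) (det_rescale01_ne_zero h01s)) (formCongr_rescale01_map_diagonal L (α ∘ ⇑τ) w (fun i => hreal w (τ i)) h01s))).continuous (ContinuousMulEquiv.restrictSubgroup (GLn.conjEquiv (Matrix.GeneralLinearGroup.mkOfDetNeZero (Matrix.diagonal ![((Real.sqrt ((w.1.embedding ((α ∘ ⇑τ) 0)).re / (w.1.embedding ((α ∘ ⇑τ) 1)).re) : ℝ) : ℂ), ((Real.sqrt ((w.1.embedding ((α ∘ ⇑τ) 1)).re / (w.1.embedding ((α ∘ ⇑τ) 0)).re) : ℝ) : ℂ), 1]) (det_rescale01_ne_zero h01s))) (archLocal L 3 (Matrix.diagonal (α ∘ ⇑τ)) w) (archLocal L 3 (Matrix.diagonal ((α ∘ ⇑τ) ∘ ⇑(Equiv.swap (0 : Fin 3) 1))) w) (mem_archLocal_diagonal_iff_conjEquiv_mem_of_formCongr_eq L 3 (α ∘ ⇑τ) ((α ∘ ⇑τ)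 ∘ ⇑(Equiv.swap (0 : Fin 3) 1)) w (Matrix.GeneralLinearGroup.mkOfDetNeZero (Matrix.diagonal ![((Real.sqrt ((w.1.embedding ((α ∘ ⇑τ) 0)).re / (w.1.embedding ((α ∘ ⇑τ) 1)).re) : ℝ) : ℂ), ((Real.sqrt ((w.1.embedding ((α ∘ ⇑τ) 1)).re / (w.1.embedding ((α ∘ ⇑τ) 0)).re) : ℝ) : ℂ), 1]) (det_rescale01_ne_zero h01s)) (formCongr_rescale01_map_diagonal L (α ∘ ⇑τ) w (fun i => hreal w (τ i)) h01s))).symm.continuous))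
    (ρZ : ∀ (w : {w : InfinitePlace L // IsComplex w}) (σ : Perm (Fin 3)), Measure (Subgroup.centralizer ({(⟨circleDiagonal 3 (z0 w ∘ ⇑σ), circleDiagonal_mem_archLocal_diagonal L 3 α w (z0 w ∘ ⇑σ)⟩ : archLocal L 3 (Matrix.diagonal α) w)} : Set (archLocal L 3 (Matrix.diagonal α) w))))
    (hρZi : ∀ w σ, (ρZ w σ).IsHaarMeasure ∧ (ρZ w σ).IsInvInvariant)
    (hρZ : ∀ (w : {w : InfinitePlace L // IsComplex w}) (σ : Perm (Fin 3)), ¬ 0 < (w.1.embedding (α (σ⁻¹ 0))).re * (w.1.embedding (α (σ⁻¹ 2))).re →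
      ρZ w σ = (νH w σ⁻¹).map (subgroupCongrHomeomorph (ContinuousMulEquiv.restrictSubgroup (GLn.conjEquiv (Matrix.GeneralLinearGroup.mkOfDetNeZero _ (det_monomial_one_ne_zero 3 σ⁻¹)))
        (archLocal L 3 (Matrix.diagonal (α ∘ ⇑σ⁻¹)) w) (archLocal L 3 (Matrix.diagonal α) w) (mem_archLocal_comp_perm_iff_conj_mem L 3 α w σ⁻¹)).toMulEquiv
        (Subgroup.centralizer ({(⟨circleDiagonal 3 (z₁ w), circleDiagonal_mem_archLocal_diagonal L 3 (α ∘ ⇑σ⁻¹) w (z₁ w)⟩ : archLocal L 3 (Matrix.diagonal (α ∘ ⇑σ⁻¹)) w)} : Set (archLocal L 3 (Matrix.diagonal (α ∘ ⇑σ⁻¹)) w)))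
        (Subgroup.centralizer ({(⟨circleDiagonal 3 (z0 w ∘ ⇑σ), circleDiagonal_mem_archLocal_diagonal L 3 α w (z0 w ∘ ⇑σ)⟩ : archLocal L 3 (Matrix.diagonal α) w)} : Set (archLocal L 3 (Matrix.diagonal α) w)))
        (relabel_inv_mem_centralizer_circleDiagonal_comp_iff L α w σ (h02 w) (h01 w) (hwall w).1 (hwall w).2)
        (ContinuousMulEquiv.restrictSubgroup (GLn.conjEquiv (Matrix.GeneralLinearGroup.mkOfDetNeZero _ (det_monomial_one_ne_zero 3 σ⁻¹)))
          (archLocal L 3 (Matrix.diagonal (α ∘ ⇑σ⁻¹)) w) (archLocal L 3 (Matrix.diagonal α) w) (mem_archLocal_comp_perm_iff_conj_mem L 3 α w σ⁻¹)).continuous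
        (ContinuousMulEquiv.restrictSubgroup (GLn.conjEquiv (Matrix.GeneralLinearGroup.mkOfDetNeZero _ (det_monomial_one_ne_zero 3 σ⁻¹)))
          (archLocal L 3 (Matrix.diagonal (α ∘ ⇑σ⁻¹)) w) (archLocal L 3 (Matrix.diagonal α) w) (mem_archLocal_comp_perm_iff_conj_mem L 3 α w σ⁻¹)).symm.continuous))
    (hρZ1 : ∀ (w : {w : InfinitePlace L // IsComplex w}) (σ : Perm (Fin 3)), 0 < (w.1.embedding (α (σ⁻¹ 0))).re * (w.1.embedding (α (σ⁻¹ 2))).re → ρZ w σ Set.univ = 1) :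
    ∃ (ρP : ∀ ρ : {w : InfinitePlace L // IsComplex w} → Perm (Fin 3), Measure (Subgroup.pi Set.univ (fun w : {w : InfinitePlace L // IsComplex w} => Subgroup.centralizer ({(⟨circleDiagonal 3 (z0 w ∘ ⇑(ρ w)), circleDiagonal_mem_archLocal_diagonal L 3 α w (z0 w ∘ ⇑(ρ w))⟩ : archLocal L 3 (Matrix.diagonal α) w)} : Set (archLocal L 3 (Matrix.diagonal α) w)))))
      (ρ' : ∀ ρ : {w : InfinitePlace L // IsComplex w} → Perm (Fin 3), Measure (Subgroup.centralizer ({archDiagTorus L 3 α (fun w => z0 w ∘ ⇑(ρ w))} : Set (arch (↥(maximalRealSubfield L)) L (IsCMField.complexConj L) 3 (Matrix.diagonal α)))))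
      (T : ∀ γ : arch (↥(maximalRealSubfield L)) L (IsCMField.complexConj L) 3 (Matrix.diagonal α), Measure (Subgroup.centralizer ({γ} : Set (arch (↥(maximalRealSubfield L)) L (IsCMField.complexConj L) 3 (Matrix.diagonal α))))),
      (∀ ρ, (ρP ρ).IsHaarMeasure ∧ (ρP ρ).IsInvInvariant) ∧
      (∀ ρ : {w : InfinitePlace L // IsComplex w} → Perm (Fin 3), Measure.map (subgroupPiCoords fun w : {w : InfinitePlace L // IsComplex w} => Subgroup.centralizer ({(⟨circleDiagonal 3 (z0 w ∘ ⇑(ρ w)), circleDiagonal_mem_archLocal_diagonal L 3 α w (z0 w ∘ ⇑(ρ w))⟩ : archLocal L 3 (Matrix.diagonal α) w)} : Set (archLocal L 3 (Matrix.diagonal α) w))) (ρP ρ) = Measure.pi fun w => ρZ w (ρ w)) ∧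
      (∀ ρ, (ρ' ρ).IsHaarMeasure ∧ (ρ' ρ).IsInvInvariant) ∧
      (∀ ρ : {w : InfinitePlace L // IsComplex w} → Perm (Fin 3), ρ' ρ = (ρP ρ).map (subgroupCongrHomeomorph (archPiEquivCM 3 L (Matrix.diagonal α)).symm.toMulEquiv (Subgroup.pi Set.univ (fun w : {w : InfinitePlace L // IsComplex w} => Subgroup.centralizer ({(⟨circleDiagonal 3 (z0 w ∘ ⇑(ρ w)), circleDiagonal_mem_archLocal_diagonal L 3 α w (z0 w ∘ ⇑(ρ w))⟩ : archLocal L 3 (Matrix.diagonal α) w)} : Set (archLocal L 3 (Matrix.diagonal α) w)))) (Subgroup.centralizer ({archDiagTorus L 3 α (fun w => z0 w ∘ ⇑(ρ w))} : Set (arch (↥(maximalRealSubfield L)) L (IsCMField.complexConj L) 3 (Matrix.diagonal α)))) (apply_mem_centralizer_iff_mem_pi_centralizer _ (archPiEquivCM 3 L (Matrix.diagonal α)).symm.toMulEquiv (archPiEquivCM_symm_circleDiagonal_eq_archDiagTorus L 3 α (fun w => z0 w ∘ ⇑(ρ w)))) (archPiEquivCM 3 L (Matrix.diagonal α)).symm.continuous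 (archPiEquivCM 3 L (Matrix.diagonal α)).continuous)) ∧
      (∀ ρ : {w : InfinitePlace L // IsComplex w} → Perm (Fin 3), T (archDiagTorus L 3 α (fun w => z0 w ∘ ⇑(ρ w))) = ρ' ρ) ∧
      (∀ γ : arch (↥(maximalRealSubfield L)) L (IsCMField.complexConj L) 3 (Matrix.diagonal α), (∃ (ρ : {w : InfinitePlace L // IsComplex w} → Perm (Fin 3)) (q : arch (↥(maximalRealSubfield L)) L (IsCMField.complexConj L) 3 (Matrix.diagonal α)), (MulAut.conj q : arch (↥(maximalRealSubfield L)) L (IsCMField.complexConj L) 3 (Matrix.diagonal α) ≃* arch (↥(maximalRealSubfield L)) L (IsCMField.complexConj L) 3 (Matrix.diagonal α)) (archDiagTorus L 3 α (fun w => z0 w ∘ ⇑(ρ w))) = γ) →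
        ∃ (ρ : {w : InfinitePlace L // IsComplex w} → Perm (Fin 3)) (q : arch (↥(maximalRealSubfield L)) L (IsCMField.complexConj L) 3 (Matrix.diagonal α)) (h : (MulAut.conj q : arch (↥(maximalRealSubfield L)) L (IsCMField.complexConj L) 3 (Matrix.diagonal α) ≃* arch (↥(maximalRealSubfield L)) L (IsCMField.complexConj L) 3 (Matrix.diagonal α)) (archDiagTorus L 3 α (fun w => z0 w ∘ ⇑(ρ w))) = γ), T γ = (ρ' ρ).map (subgroupCongrHomeomorph (MulAut.conj q : arch (↥(maximalRealSubfield L)) L (IsCMField.complexConj L) 3 (Matrix.diagonal α) ≃* arch (↥(maximalRealSubfield L)) L (IsCMField.complexConj L) 3 (Matrix.diagonal α)) (Subgroup.centralizer ({archDiagTorus L 3 α (fun w => z0 w ∘ ⇑(ρ w))} : Set (arch (↥(maximalRealSubfield L)) L (IsCMField.complexConj L) 3 (Matrix.diagonal α)))) (Subgroup.centralizer ({γ} : Set (arch (↥(maximalRealSubfield L)) L (IsCMField.complexConj L) 3 (Matrix.diagonal α)))) (forall_apply_mem_centralizer_singleton_iff_of_eq (MulAut.conj q : arch (↥(maximalRealSubfield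 L)) L (IsCMField.complexConj L) 3 (Matrix.diagonal α) ≃* arch (↥(maximalRealSubfield L)) L (IsCMField.complexConj L) 3 (Matrix.diagonal α)) h) (continuous_mulAutConj q) (continuous_mulAutConj_symm q))) ∧
      (∀ γ : arch (↥(maximalRealSubfield L)) L (IsCMField.complexConj L) 3 (Matrix.diagonal α), (∃ (ρ : {w : InfinitePlace L // IsComplex w} → Perm (Fin 3)) (q : arch (↥(maximalRealSubfield L)) L (IsCMField.complexConj L) 3 (Matrix.diagonal α)), (MulAut.conj q : arch (↥(maximalRealSubfield L)) L (IsCMField.complexConj L) 3 (Matrix.diagonal α) ≃* arch (↥(maximalRealSubfield L)) L (IsCMField.complexConj L) 3 (Matrix.diagonal α)) (archDiagTorus L 3 α (fun w => z0 w ∘ ⇑(ρ w))) = γ) → (T γ).IsHaarMeasure ∧ (T γ).IsInvInvariant) ∧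
      ∀ (γ₁ γ₂ Q : arch (↥(maximalRealSubfield L)) L (IsCMField.complexConj L) 3 (Matrix.diagonal α)) (hQ : (MulAut.conj Q : arch (↥(maximalRealSubfield L)) L (IsCMField.complexConj L) 3 (Matrix.diagonal α) ≃* arch (↥(maximalRealSubfield L)) L (IsCMField.complexConj L) 3 (Matrix.diagonal α)) γ₁ = γ₂), (∃ (ρ : {w : InfinitePlace L // IsComplex w} → Perm (Fin 3)) (q : arch (↥(maximalRealSubfield L)) L (IsCMField.complexConj L) 3 (Matrix.diagonal α)), (MulAut.conj q : arch (↥(maximalRealSubfield L)) L (IsCMField.complexConj L) 3 (Matrix.diagonal α) ≃* arch (↥(maximalRealSubfield L)) L (IsCMField.complexConj L) 3 (Matrix.diagonal α)) (archDiagTorus L 3 α (fun w => z0 w ∘ ⇑(ρ w))) = γ₁) →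
        (T γ₁).map (subgroupCongrHomeomorph (MulAut.conj Q : arch (↥(maximalRealSubfield L)) L (IsCMField.complexConj L) 3 (Matrix.diagonal α) ≃* arch (↥(maximalRealSubfield L)) L (IsCMField.complexConj L) 3 (Matrix.diagonal α)) (Subgroup.centralizer ({γ₁} : Set (arch (↥(maximalRealSubfield L)) L (IsCMField.complexConj L) 3 (Matrix.diagonal α)))) (Subgroup.centralizer ({γ₂} : Set (arch (↥(maximalRealSubfield L)) L (IsCMField.complexConj L) 3 (Matrix.diagonal α)))) (forall_apply_mem_centralizer_singleton_iff_of_eq (MulAut.conj Q : arch (↥(maximalRealSubfield L)) L (IsCMField.complexConj L) 3 (Matrix.diagonal α) ≃* arch (↥(maximalRealSubfield L)) L (IsCMField.complexConj L) 3 (Matrix.diagonal α)) hQ) (continuous_mulAutConj Q) (continuous_mulAutConj_symm Q)) = T γ₂ :=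
  haveI : ∀ w : {w : InfinitePlace L // IsComplex w}, SecondCountableTopology (archLocal L 3 (Matrix.diagonal α) w) := fun w => secondCountableTopology_archLocal L 3 (Matrix.diagonal α) w
  haveI : ∀ w : {w : InfinitePlace L // IsComplex w}, LocallyCompactSpace (archLocal L 3 (Matrix.diagonal α) w) := fun w => locallyCompactSpace_archLocal L 3 (Matrix.diagonal α) w
  exists_conj_coherent_pinned_telescope L α z0 ρZ hρZi (fun w σ₁ σ₂ g hg =>
    centralizer_measure_family_conj_coherent L α w hα (hreal w) (h02 w) (h01 w) (hwall w).1 (hwall w).2 (νH w) (hT02 w) (hT01 w) (ρZ w) (hρZ w) (hρZi w) (hρZ1 w) σ₁ σ₂ g hg)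

end Pins

end Literature.NumberTheory.Rogawski1990

end
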